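import Mathlib
import HarnessLib
import Summits.NavierStokesRegularity.NavierStokesRegularity.Theorems.TypeILiouvilleShorelineLocalSymmetry
import Literature.Analysis.FluidPDE.KNSSAxisymmetricNoSwirlHolds
import Literature.Analysis.FluidPDE.AxisymmetricReflection
import Literature.Analysis.FluidPDE.BoundedWeakIsometry

/-!
# TypeILiouvilleAxisymSectors — crux (L) stmt-NavierStokesRegularity-10661 `TypeIliouvilleL`:
# THE AXISYMMETRIC STRATA OF KOCH–NADIRASHVILI–SEREGIN–ŠVERÁK ON PRINT'S CLASS, LOCALIZED TO ONE PATCH OF ONE SLICE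

Helper for stmt-NavierStokesRegularity-10661 (`--supports`); theorems only, no definitions, no named-fact
hypotheses; closes no item; Navier–Stokes regularity is NOT proved here (leafhand seat of the EulerZoomLiouville
route; sequel to `TypeILiouvilleShorelineContinuation` / `…LocalSymmetry`, whose one-patch determination is the engine).

Class P = print's class of bounded ancient mild solutions (KNSS 2009 §4 (i); the class of the registered stubs
`stub_quiescentLiouville` (L_Q) and `stub_persistent_mild_backward_L3_recurrence` (S3ᵐ) of the crux):
`v : ℝ → ℝ³ → ℝ³` continuous and bounded on `(−∞,0) × ℝ³`, weakly divergence free on every slice, with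
`v(t) = e^{(t−s)Δ}v(s) − B¹_s(v,v)(t)` for `s < t < 0`.  The two PROVED cases of (L) in print — KNSS 2009
Theorem 5.2 (axisymmetric without swirl) and Theorem 5.3 (axisymmetric with `|v| ≤ C/r`) — are theorems of the
tree in the duality-form class (`Literature.Analysis.FluidPDE.knss_axisymmetric_no_swirl_holds`,
`Literature.Analysis.FluidPDE.knss_bound_C_over_r_holds`).  This file transports them to class P and LOCALIZES
the symmetry hypotheses to one open patch of one slice:

* §1 `classP_axial_of_axisymmetric_noSwirl` — a class-P flow with axisymmetric swirl-free slices is ONE constant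
  AXIAL vector `β • e_z` (Thm 5.2 + continuity + KNSS Remark 6.1); `classP_zero_of_axisymmetric_rBound` — a
  class-P flow with axisymmetric slices and `r‖v(t,x)‖ ≤ C` vanishes identically (Thm 5.3).
* §2 LOCAL ⟹ GLOBAL: `classP_isAxisymmetric_of_locally` — coincidence with every rotated twin
  `R_θ (v t₀ (R_θ⁻¹ x))` on ONE nonempty open set of ONE slice forces axisymmetry of every slice (one-patch
  determination `classP_symmetric_of_locally_symmetric`); `classP_hasNoSwirl_slice_of_locally` — the swirl
  `Γ = x₀v₁ − x₁v₀` of an analytic slice vanishing on an open set vanishes on the slice;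
  `classP_hasNoSwirl_of_axisymmetric_of_slice` — for an axisymmetric class-P flow, NO SWIRL ON ONE SLICE ⟹ NO
  SWIRL ON EVERY SLICE, past and future (swirl-free axisymmetric = equivariant under the meridian reflection `σ`,
  `IsAxisymmetric.hasNoSwirl_iff_reflY`; the `σ`-twin is in class P and agrees with `v` on that slice, so
  everywhere — no swirl transport equation, no maximum principle); `classP_hasNoSwirl_of_spacetime_locally` —
  the space–time patch version (joint analyticity).
* §3 THE LOCALIZED SECTOR: `classP_axial_of_locally_axisymmetric_noSwirl` /
  `classP_const_of_locally_axisymmetric_noSwirl` — **a class-P flow which, on ONE nonempty open patch of ONE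
  slice, coincides with all its rotated twins about the axis and is swirl-free there, is one constant axial
  vector**; `classP_const_of_locally_axisymmetric_noSwirl_anyAxis` — the same about ANY line `a + A⁻¹(ℝe_z)`
  (Euclidean covariance of class P: `classP_spaceShift`, `classP_conj_linearIsometryEquiv`);
  `classP_zero_of_locally_axisymmetric_rBound` — local rotational symmetry + the global bound `r‖v‖ ≤ C` ⟹ `v ≡ 0`.

READING on the registered residuals L_Q / BCL / LSL / S3ᵐ of the (L) crux (all stated over class P): each holds
OUTRIGHT on the stratum of flows that are axisymmetric-without-swirl about some line NEAR ONE SPACE–TIME POINT;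
with `TypeILiouvilleShorelineSectors` / `…PlanarWallAnyDirection` / `…LocalSymmetry` a counterexample to (L) is
nowhere locally irrotational, nowhere locally 2½-dimensional, nowhere locally steady/periodic, and (here) nowhere
locally axisymmetric-without-swirl.  The axisymmetric stratum WITH swirl (AXL, KNSS 2009 p. 10 open problem; node
`TypeILiouvilleAxisTest`) is untouched.
[cite: KochNadirashviliSereginSverak2009, Thms 5.2–5.3 (arXiv:0709.3599 pp. 9–10), §4 (i), Remark 6.1]
[cite: MajdaBertozziCUP2002, §2.3.3 (2.52)–(2.53)] [cite: LemarieRieusset2016, Thm. 9.12 (PDF p. 260)]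
-/

noncomputable section

open MeasureTheory Filter Set Function Metric
open scoped Topology
open Literature.Analysis Literature.Analysis.FluidPDE Literature.Analysis.UnboundedOperators
open Summit.NavierStokesRegularity.NavierStokesRegularity.Theorems.TypeILiouvilleShoreline

set_option linter.dupNamespace false

namespace Summit.NavierStokesRegularity.NavierStokesRegularity.Theorems.TypeILiouvilleAxisymSectors

/-! ## §0 Class P sits in the duality-form class with continuous slices -/

/-- A class-P flow is a bounded ancient mild solution in the tree's duality form (`ν = 1`) with (strongly
measurable, indeed) continuous slices (Lemarié-Rieusset 2016 Thm 6.1 via the tree's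
`isBoundedAncientMildSolution_of_oseen`). [cite: KochNadirashviliSereginSverak2009, §4 (i) (arXiv:0709.3599 p. 8)] -/
theorem classP_isBoundedAncientMildSolution
    {v : ℝ → EuclideanSpace ℝ (Fin 3) → EuclideanSpace ℝ (Fin 3)}
    (hc : ContinuousOn (uncurry v) (Iio 0 ×ˢ univ))
    (hK : ∃ K : ℝ, ∀ t < 0, ∀ x, ‖v t x‖ ≤ K)
    (hd : ∀ t < 0, IsWeaklyDivFree (v t))
    (hm : ∀ s t : ℝ, s < t → t < 0 → ∀ x,
      v t x = heatExtension (v s) (t - s) x - oseenDuhamel 1 s v v t x) :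
    IsBoundedAncientMildSolution 1 v ∧ (∀ t < 0, Continuous (v t)) ∧
      (∀ t < 0, AEStronglyMeasurable (v t) volume) := by
  have hm1 : ∀ s t : ℝ, s < t → t < 0 → ∀ x,
      v t x = heatExtension (v s) (1 * (t - s)) x - oseenDuhamel 1 s v v t x :=
    fun s t hst ht x => by rw [one_mul]; exact hm s t hst ht x
  have hvc : ∀ t < 0, Continuous (v t) := fun t ht =>
    hc.comp_continuous (Continuous.prodMk_right t) fun x => mem_prod.2 ⟨ht, mem_univ x⟩
  exact ⟨isBoundedAncientMildSolution_of_oseen one_pos hc hK hd hm1, hvc,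
    fun t ht => (hvc t ht).aestronglyMeasurable⟩

/-- KNSS Remark 6.1 on class P: if every slice is a constant vector `b t`, the constants agree. [cite: KochNadirashviliSereginSverak2009, Remark 6.1 (arXiv:0709.3599)] -/
theorem classP_sliceConst_agree
    {v : ℝ → EuclideanSpace ℝ (Fin 3) → EuclideanSpace ℝ (Fin 3)}
    (hm : ∀ s t : ℝ, s < t → t < 0 → ∀ x,
      v t x = heatExtension (v s) (t - s) x - oseenDuhamel 1 s v v t x)
    {b : ℝ → EuclideanSpace ℝ (Fin 3)} (hb : ∀ t < 0, ∀ x, v t x = b t) :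
    ∀ s t : ℝ, s < 0 → t < 0 → b s = b t :=
  KNSS2009_remark61 one_pos hb fun s t hst ht => Eventually.of_forall fun x => by
    rw [one_mul]; exact hm s t hst ht x

/-! ## §1 The two KNSS strata on class P (global hypotheses) -/

/-- **KNSS Theorem 5.2 on class P: axisymmetric without swirl ⟹ ONE constant axial vector.**  Every slice is
a.e. `β(t) • e_z` (`knss_axisymmetric_no_swirl_holds`), hence equal to it (continuity), and the `β(t)` agree
(Remark 6.1). [cite: KochNadirashviliSereginSverak2009, Thm 5.2 (arXiv:0709.3599 pp. 9–10)] -/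
theorem classP_axial_of_axisymmetric_noSwirl
    {v : ℝ → EuclideanSpace ℝ (Fin 3) → EuclideanSpace ℝ (Fin 3)}
    (hc : ContinuousOn (uncurry v) (Iio 0 ×ˢ univ))
    (hK : ∃ K : ℝ, ∀ t < 0, ∀ x, ‖v t x‖ ≤ K)
    (hd : ∀ t < 0, IsWeaklyDivFree (v t))
    (hm : ∀ s t : ℝ, s < t → t < 0 → ∀ x,
      v t x = heatExtension (v s) (t - s) x - oseenDuhamel 1 s v v t x)
    (haxi : ∀ t < 0, IsAxisymmetric (v t)) (hsw : ∀ t < 0, HasNoSwirl (v t)) :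
    ∃ β : ℝ, ∀ t < 0, ∀ x, v t x = β • eZ := by
  classical
  obtain ⟨hv, hvc, hmeas⟩ := classP_isBoundedAncientMildSolution hc hK hd hm
  have hslice : ∀ t < 0, ∃ β : ℝ, ∀ x, v t x = β • eZ := by
    intro t ht
    obtain ⟨β, hβ⟩ := knss_axisymmetric_no_swirl_holds hv hmeas haxi hsw t ht
    have : v t = fun _ => β • eZ :=
      (Continuous.ae_eq_iff_eq volume (hvc t ht) continuous_const).1 hβ
    exact ⟨β, fun x => congrFun this x⟩
  set β : ℝ → ℝ := fun t => if ht : t < 0 then Classical.choose (hslice t ht) else 0 with hβ_def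
  have hub : ∀ t < 0, ∀ x, v t x = β t • eZ := by
    intro t ht x
    have h := Classical.choose_spec (hslice t ht) x
    simp only [hβ_def, dif_pos ht]
    exact h
  have htime := classP_sliceConst_agree hm (b := fun t => β t • eZ) hub
  refine ⟨β (-1), fun t ht x => ?_⟩
  rw [hub t ht x]
  exact htime t (-1) ht (by norm_num)

/-- **KNSS Theorem 5.3 on class P: axisymmetric with `r‖v(t,x)‖ ≤ C` ⟹ `v ≡ 0`** (`knss_bound_C_over_r_holds` +
continuity of the slices). [cite: KochNadirashviliSereginSverak2009, Thm 5.3 (arXiv:0709.3599 p. 10)] -/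
theorem classP_zero_of_axisymmetric_rBound
    {v : ℝ → EuclideanSpace ℝ (Fin 3) → EuclideanSpace ℝ (Fin 3)}
    (hc : ContinuousOn (uncurry v) (Iio 0 ×ˢ univ))
    (hK : ∃ K : ℝ, ∀ t < 0, ∀ x, ‖v t x‖ ≤ K)
    (hd : ∀ t < 0, IsWeaklyDivFree (v t))
    (hm : ∀ s t : ℝ, s < t → t < 0 → ∀ x,
      v t x = heatExtension (v s) (t - s) x - oseenDuhamel 1 s v v t x)
    (haxi : ∀ t < 0, IsAxisymmetric (v t))
    (hr : ∃ C : ℝ, ∀ t < 0, ∀ x, cylRadius x * ‖v t x‖ ≤ C) :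
    ∀ t < 0, ∀ x, v t x = 0 := by
  obtain ⟨hv, hvc, hmeas⟩ := classP_isBoundedAncientMildSolution hc hK hd hm
  intro t ht x
  have hae := knss_bound_C_over_r_holds hv hmeas haxi hr t ht
  have : v t = fun _ => (0 : EuclideanSpace ℝ (Fin 3)) :=
    (Continuous.ae_eq_iff_eq volume (hvc t ht) continuous_const).1 hae
  exact congrFun this x

/-! ## §2 Local ⟹ global: rotational symmetry, and the swirl -/

/-- **LOCAL ROTATIONAL SYMMETRY IS GLOBAL AXISYMMETRY.**  If on ONE nonempty open set `U` of ONE slice `t₀ < 0`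
the flow coincides with each of its rotated twins, `v t₀ x = R_θ (v t₀ (R_θ⁻¹ x))` (`x ∈ U`, all `θ`), then
every slice is axisymmetric (one-patch determination for `v` and each twin, `classP_symmetric_of_locally_symmetric`;
`isAxisymmetric_iff_conj_rotZLIE`). [cite: LemarieRieusset2016, Thm. 9.12 (PDF p. 260)] -/
theorem classP_isAxisymmetric_of_locally
    {v : ℝ → EuclideanSpace ℝ (Fin 3) → EuclideanSpace ℝ (Fin 3)}
    (hc : ContinuousOn (uncurry v) (Iio 0 ×ˢ univ))
    (hK : ∃ K : ℝ, ∀ t < 0, ∀ x, ‖v t x‖ ≤ K)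
    (hm : ∀ s t : ℝ, s < t → t < 0 → ∀ x,
      v t x = heatExtension (v s) (t - s) x - oseenDuhamel 1 s v v t x)
    {t₀ : ℝ} (ht₀ : t₀ < 0) {U : Set (EuclideanSpace ℝ (Fin 3))} (hUo : IsOpen U) (hUne : U.Nonempty)
    (hrot : ∀ θ : ℝ, ∀ x ∈ U, v t₀ x = rotZLIE θ (v t₀ ((rotZLIE θ).symm x))) :
    ∀ t < 0, IsAxisymmetric (v t) := by
  intro t ht
  rw [isAxisymmetric_iff_conj_rotZLIE]
  intro θ x
  exact (classP_symmetric_of_locally_symmetric hc hK hm (rotZLIE θ) ht₀ hUo hUne (hrot θ) t ht x).symm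

/-- **The swirl of an analytic slice vanishing on an open set vanishes on the slice** (`Γ = x₀ v₁ − x₁ v₀` is
real-analytic with the slice, `classP_analyticOnNhd_slice`; identity theorem on the connected `ℝ³`). [cite: LemarieRieusset2016, Thm. 9.12 (PDF p. 260)] -/
theorem classP_hasNoSwirl_slice_of_locally
    {v : ℝ → EuclideanSpace ℝ (Fin 3) → EuclideanSpace ℝ (Fin 3)}
    (hc : ContinuousOn (uncurry v) (Iio 0 ×ˢ univ))
    (hK : ∃ K : ℝ, ∀ t < 0, ∀ x, ‖v t x‖ ≤ K)
    (hm : ∀ s t : ℝ, s < t → t < 0 → ∀ x,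
      v t x = heatExtension (v s) (t - s) x - oseenDuhamel 1 s v v t x)
    {t₀ : ℝ} (ht₀ : t₀ < 0) {U : Set (EuclideanSpace ℝ (Fin 3))} (hUo : IsOpen U) (hUne : U.Nonempty)
    (hsw : ∀ x ∈ U, swirl (v t₀) x = 0) :
    HasNoSwirl (v t₀) := by
  have han : AnalyticOnNhd ℝ (v t₀) univ := classP_analyticOnNhd_slice hc hK hm ht₀
  -- the swirl is real-analytic on `ℝ³`
  have hΓ : AnalyticOnNhd ℝ (swirl (v t₀)) univ := by
    intro x _
    have h0 : AnalyticAt ℝ (fun y : EuclideanSpace ℝ (Fin 3) => y 0) x :=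
      (EuclideanSpace.proj (𝕜 := ℝ) (0 : Fin 3)).analyticAt x
    have h1 : AnalyticAt ℝ (fun y : EuclideanSpace ℝ (Fin 3) => y 1) x :=
      (EuclideanSpace.proj (𝕜 := ℝ) (1 : Fin 3)).analyticAt x
    have hu0 : AnalyticAt ℝ (fun y => v t₀ y 0) x :=
      ((EuclideanSpace.proj (𝕜 := ℝ) (0 : Fin 3)).analyticAt (v t₀ x)).comp (han x (mem_univ _))
    have hu1 : AnalyticAt ℝ (fun y => v t₀ y 1) x :=
      ((EuclideanSpace.proj (𝕜 := ℝ) (1 : Fin 3)).analyticAt (v t₀ x)).comp (han x (mem_univ _))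
    have hdef : swirl (v t₀) = fun y => y 0 * v t₀ y 1 - y 1 * v t₀ y 0 := rfl
    rw [hdef]
    exact (h0.mul hu1).sub (h1.mul hu0)
  obtain ⟨z₀, hz₀⟩ := hUne
  have hev : swirl (v t₀) =ᶠ[𝓝 z₀] 0 := by filter_upwards [hUo.mem_nhds hz₀] with y hy using hsw y hy
  exact fun x => hΓ.eqOn_zero_of_preconnected_of_eventuallyEq_zero
    (convex_univ (𝕜 := ℝ) (E := EuclideanSpace ℝ (Fin 3))).isPreconnected (mem_univ z₀) hev (mem_univ x)

/-- **For an axisymmetric class-P flow, no swirl on ONE slice ⟹ no swirl on EVERY slice (past and future).**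
Swirl-free axisymmetric fields are exactly the axisymmetric fields fixed by conjugation with the meridian reflection
`σ (x₀,x₁,x₂) = (x₀,−x₁,x₂)` (`IsAxisymmetric.hasNoSwirl_iff_reflY`); the `σ`-twin of `v` is in class P and coincides
with `v` on the slice `t₀`, hence on the whole slab (one-patch determination); so every slice is `σ`-symmetric and,
being axisymmetric, swirl-free.  No swirl equation and no maximum principle are used. [cite: MajdaBertozziCUP2002, §2.3.3 (2.52)–(2.53)] -/
theorem classP_hasNoSwirl_of_axisymmetric_of_slice
    {v : ℝ → EuclideanSpace ℝ (Fin 3) → EuclideanSpace ℝ (Fin 3)}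
    (hc : ContinuousOn (uncurry v) (Iio 0 ×ˢ univ))
    (hK : ∃ K : ℝ, ∀ t < 0, ∀ x, ‖v t x‖ ≤ K)
    (hm : ∀ s t : ℝ, s < t → t < 0 → ∀ x,
      v t x = heatExtension (v s) (t - s) x - oseenDuhamel 1 s v v t x)
    (haxi : ∀ t < 0, IsAxisymmetric (v t)) {t₀ : ℝ} (ht₀ : t₀ < 0) (hsw₀ : HasNoSwirl (v t₀)) :
    ∀ t < 0, HasNoSwirl (v t) := by
  have hloc : ∀ x ∈ (univ : Set (EuclideanSpace ℝ (Fin 3))), v t₀ x = reflY (v t₀ (reflY.symm x)) :=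
    fun x _ => ((haxi t₀ ht₀).conj_reflY_eq hsw₀ x).symm
  have hglob := classP_symmetric_of_locally_symmetric hc hK hm reflY ht₀ isOpen_univ univ_nonempty hloc
  intro t ht
  exact (haxi t ht).hasNoSwirl_of_conj_reflY_eq fun x => (hglob t ht x).symm

/-- **No swirl on a nonempty open SPACE–TIME set ⟹ no swirl on the slab** (the swirl `(t,x) ↦ Γ_{v(t)}(x)` is
jointly real-analytic with `v`, `classP_analyticOnNhd_uncurry`; the slab is preconnected). [cite: LemarieRieusset2016, Thm. 9.12 (PDF p. 260)] -/
theorem classP_hasNoSwirl_of_spacetime_locally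
    {v : ℝ → EuclideanSpace ℝ (Fin 3) → EuclideanSpace ℝ (Fin 3)}
    (hc : ContinuousOn (uncurry v) (Iio 0 ×ˢ univ))
    (hK : ∃ K : ℝ, ∀ t < 0, ∀ x, ‖v t x‖ ≤ K)
    (hm : ∀ s t : ℝ, s < t → t < 0 → ∀ x,
      v t x = heatExtension (v s) (t - s) x - oseenDuhamel 1 s v v t x)
    {W : Set (ℝ × EuclideanSpace ℝ (Fin 3))} (hWo : IsOpen W) (hWne : W.Nonempty) (hWsub : W ⊆ Iio 0 ×ˢ univ)
    (hsw : ∀ p ∈ W, swirl (v p.1) p.2 = 0) :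
    ∀ t < 0, HasNoSwirl (v t) := by
  have han := classP_analyticOnNhd_uncurry hc hK hm
  -- the space–time swirl is jointly analytic on the slab
  set Γ : ℝ × EuclideanSpace ℝ (Fin 3) → ℝ := fun p => swirl (v p.1) p.2 with hΓ_def
  have hΓ : AnalyticOnNhd ℝ Γ (Iio (0 : ℝ) ×ˢ (univ : Set (EuclideanSpace ℝ (Fin 3)))) := by
    intro p hp
    have hsnd : AnalyticAt ℝ (fun q : ℝ × EuclideanSpace ℝ (Fin 3) => q.2) p := analyticAt_snd
    have h0 : AnalyticAt ℝ (fun q : ℝ × EuclideanSpace ℝ (Fin 3) => q.2 0) p :=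
      ((EuclideanSpace.proj (𝕜 := ℝ) (0 : Fin 3)).analyticAt p.2).comp hsnd
    have h1 : AnalyticAt ℝ (fun q : ℝ × EuclideanSpace ℝ (Fin 3) => q.2 1) p :=
      ((EuclideanSpace.proj (𝕜 := ℝ) (1 : Fin 3)).analyticAt p.2).comp hsnd
    have hu0 : AnalyticAt ℝ (fun q : ℝ × EuclideanSpace ℝ (Fin 3) => uncurry v q 0) p :=
      ((EuclideanSpace.proj (𝕜 := ℝ) (0 : Fin 3)).analyticAt (uncurry v p)).comp (han p hp)
    have hu1 : AnalyticAt ℝ (fun q : ℝ × EuclideanSpace ℝ (Fin 3) => uncurry v q 1) p :=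
      ((EuclideanSpace.proj (𝕜 := ℝ) (1 : Fin 3)).analyticAt (uncurry v p)).comp (han p hp)
    have hdef : Γ = fun q : ℝ × EuclideanSpace ℝ (Fin 3) => q.2 0 * uncurry v q 1 - q.2 1 * uncurry v q 0 := by
      funext q; rfl
    rw [hdef]
    exact (h0.mul hu1).sub (h1.mul hu0)
  obtain ⟨p₀, hp₀⟩ := hWne
  have hev : Γ =ᶠ[𝓝 p₀] 0 := by filter_upwards [hWo.mem_nhds hp₀] with q hq using hsw q hq
  have hzero := hΓ.eqOn_zero_of_preconnected_of_eventuallyEq_zero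
    ((convex_Iio (0 : ℝ)).prod convex_univ).isPreconnected (hWsub hp₀) hev
  exact fun t ht x => hzero (show ((t, x) : ℝ × EuclideanSpace ℝ (Fin 3)) ∈
    Iio (0 : ℝ) ×ˢ (univ : Set (EuclideanSpace ℝ (Fin 3))) from mem_prod.2 ⟨mem_Iio.2 ht, mem_univ x⟩)

/-! ## §3 The localized sectors -/

/-- **THE LOCALIZED KNSS-5.2 SECTOR (axial form).**  A class-P flow which, on ONE nonempty open patch `U` of ONE
slice `t₀ < 0`, coincides with all its rotated twins about the axis and is swirl-free on `U`, is one constant axial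
vector `β • e_z` (§2 local ⟹ global, then §1). [cite: KochNadirashviliSereginSverak2009, Thm 5.2 (arXiv:0709.3599 pp. 9–10)] -/
theorem classP_axial_of_locally_axisymmetric_noSwirl
    {v : ℝ → EuclideanSpace ℝ (Fin 3) → EuclideanSpace ℝ (Fin 3)}
    (hc : ContinuousOn (uncurry v) (Iio 0 ×ˢ univ))
    (hK : ∃ K : ℝ, ∀ t < 0, ∀ x, ‖v t x‖ ≤ K)
    (hd : ∀ t < 0, IsWeaklyDivFree (v t))
    (hm : ∀ s t : ℝ, s < t → t < 0 → ∀ x,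
      v t x = heatExtension (v s) (t - s) x - oseenDuhamel 1 s v v t x)
    {t₀ : ℝ} (ht₀ : t₀ < 0) {U : Set (EuclideanSpace ℝ (Fin 3))} (hUo : IsOpen U) (hUne : U.Nonempty)
    (hrot : ∀ θ : ℝ, ∀ x ∈ U, v t₀ x = rotZLIE θ (v t₀ ((rotZLIE θ).symm x)))
    (hsw : ∀ x ∈ U, swirl (v t₀) x = 0) :
    ∃ β : ℝ, ∀ t < 0, ∀ x, v t x = β • eZ := by
  have haxi := classP_isAxisymmetric_of_locally hc hK hm ht₀ hUo hUne hrot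
  have hsw₀ := classP_hasNoSwirl_slice_of_locally hc hK hm ht₀ hUo hUne hsw
  exact classP_axial_of_axisymmetric_noSwirl hc hK hd hm haxi
    (classP_hasNoSwirl_of_axisymmetric_of_slice hc hK hm haxi ht₀ hsw₀)

/-- **THE LOCALIZED KNSS-5.2 SECTOR (the conclusion of L_Q / BCL / LSL / S3ᵐ-Liouville verbatim).**  A class-P flow
locally axisymmetric-without-swirl near one space–time point is one constant vector. [cite: KochNadirashviliSereginSverak2009, Thm 5.2 (arXiv:0709.3599 pp. 9–10)] -/
theorem classP_const_of_locally_axisymmetric_noSwirl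
    {v : ℝ → EuclideanSpace ℝ (Fin 3) → EuclideanSpace ℝ (Fin 3)}
    (hc : ContinuousOn (uncurry v) (Iio 0 ×ˢ univ))
    (hK : ∃ K : ℝ, ∀ t < 0, ∀ x, ‖v t x‖ ≤ K)
    (hd : ∀ t < 0, IsWeaklyDivFree (v t))
    (hm : ∀ s t : ℝ, s < t → t < 0 → ∀ x,
      v t x = heatExtension (v s) (t - s) x - oseenDuhamel 1 s v v t x)
    {t₀ : ℝ} (ht₀ : t₀ < 0) {U : Set (EuclideanSpace ℝ (Fin 3))} (hUo : IsOpen U) (hUne : U.Nonempty)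
    (hrot : ∀ θ : ℝ, ∀ x ∈ U, v t₀ x = rotZLIE θ (v t₀ ((rotZLIE θ).symm x)))
    (hsw : ∀ x ∈ U, swirl (v t₀) x = 0) :
    ∃ b : EuclideanSpace ℝ (Fin 3), ∀ t < 0, ∀ x, v t x = b := by
  obtain ⟨β, hβ⟩ := classP_axial_of_locally_axisymmetric_noSwirl hc hK hd hm ht₀ hUo hUne hrot hsw
  exact ⟨β • eZ, hβ⟩

/-- **ANY AXIS.**  Let `A` be a linear isometry of `ℝ³` and `a ∈ ℝ³`, and let `w t x = A (v t (A⁻¹ x + a))` be the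
flow `v` read in the Euclidean frame in which the line `{a + A⁻¹ (s e_z)}` is the axis.  If `w` is, on one nonempty
open patch of one slice, rotationally symmetric about the axis and swirl-free there, then `v` is one constant vector
(class P is invariant under the Euclidean group: `classP_spaceShift`, `classP_conj_linearIsometryEquiv`,
`IsWeaklyDivFree.comp_add_right'`, `IsWeaklyDivFree.conj_linearIsometryEquiv`). [cite: KochNadirashviliSereginSverak2009, Thm 5.2 and §4 (arXiv:0709.3599)] -/
theorem classP_const_of_locally_axisymmetric_noSwirl_anyAxis
    {v : ℝ → EuclideanSpace ℝ (Fin 3) → EuclideanSpace ℝ (Fin 3)}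
    (hc : ContinuousOn (uncurry v) (Iio 0 ×ˢ univ))
    (hK : ∃ K : ℝ, ∀ t < 0, ∀ x, ‖v t x‖ ≤ K)
    (hd : ∀ t < 0, IsWeaklyDivFree (v t))
    (hm : ∀ s t : ℝ, s < t → t < 0 → ∀ x,
      v t x = heatExtension (v s) (t - s) x - oseenDuhamel 1 s v v t x)
    (A : EuclideanSpace ℝ (Fin 3) ≃ₗᵢ[ℝ] EuclideanSpace ℝ (Fin 3)) (a : EuclideanSpace ℝ (Fin 3))
    {t₀ : ℝ} (ht₀ : t₀ < 0) {U : Set (EuclideanSpace ℝ (Fin 3))} (hUo : IsOpen U) (hUne : U.Nonempty)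
    (hrot : ∀ θ : ℝ, ∀ x ∈ U,
      A (v t₀ (A.symm x + a)) = rotZLIE θ (A (v t₀ (A.symm ((rotZLIE θ).symm x) + a))))
    (hsw : ∀ x ∈ U, swirl (fun y => A (v t₀ (A.symm y + a))) x = 0) :
    ∃ b : EuclideanSpace ℝ (Fin 3), ∀ t < 0, ∀ x, v t x = b := by
  -- translate by `a`, then conjugate by `A`: the frame flow `w` is in class P
  obtain ⟨h1c, h1K, h1m⟩ := classP_spaceShift hc hK hm a
  have h1d : ∀ t < 0, IsWeaklyDivFree (fun x => v t (x + a)) := fun t ht => (hd t ht).comp_add_right' a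
  obtain ⟨h2c, h2K, h2m⟩ := classP_conj_linearIsometryEquiv (v := fun t x => v t (x + a)) h1c h1K h1m A
  have h2d : ∀ t < 0, IsWeaklyDivFree (fun x => A (v t (A.symm x + a))) := fun t ht =>
    (h1d t ht).conj_linearIsometryEquiv A
  obtain ⟨b, hb⟩ := classP_const_of_locally_axisymmetric_noSwirl (v := fun t x => A (v t (A.symm x + a)))
    h2c h2K h2d h2m ht₀ hUo hUne hrot hsw
  refine ⟨A.symm b, fun t ht y => ?_⟩
  have h := hb t ht (A (y - a))
  simp only [LinearIsometryEquiv.symm_apply_apply, sub_add_cancel] at h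
  rw [← h, LinearIsometryEquiv.symm_apply_apply]

/-- **THE LOCALIZED KNSS-5.3 SECTOR.**  A class-P flow which coincides with all its rotated twins about the axis on
ONE nonempty open patch of ONE slice and obeys the global bound `r‖v(t,x)‖ ≤ C` vanishes identically (§2 + Thm 5.3).
[cite: KochNadirashviliSereginSverak2009, Thm 5.3 (arXiv:0709.3599 p. 10)] -/
theorem classP_zero_of_locally_axisymmetric_rBound
    {v : ℝ → EuclideanSpace ℝ (Fin 3) → EuclideanSpace ℝ (Fin 3)}
    (hc : ContinuousOn (uncurry v) (Iio 0 ×ˢ univ))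
    (hK : ∃ K : ℝ, ∀ t < 0, ∀ x, ‖v t x‖ ≤ K)
    (hd : ∀ t < 0, IsWeaklyDivFree (v t))
    (hm : ∀ s t : ℝ, s < t → t < 0 → ∀ x,
      v t x = heatExtension (v s) (t - s) x - oseenDuhamel 1 s v v t x)
    {t₀ : ℝ} (ht₀ : t₀ < 0) {U : Set (EuclideanSpace ℝ (Fin 3))} (hUo : IsOpen U) (hUne : U.Nonempty)
    (hrot : ∀ θ : ℝ, ∀ x ∈ U, v t₀ x = rotZLIE θ (v t₀ ((rotZLIE θ).symm x)))
    (hr : ∃ C : ℝ, ∀ t < 0, ∀ x, cylRadius x * ‖v t x‖ ≤ C) :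
    ∀ t < 0, ∀ x, v t x = 0 :=
  classP_zero_of_axisymmetric_rBound hc hK hd hm (classP_isAxisymmetric_of_locally hc hK hm ht₀ hUo hUne hrot) hr

/-! ## §4 Readings on the registered residuals of the (L) crux -/

/-- **L_Q (registered `stub_quiescentLiouville`) HOLDS on the locally-axisymmetric-without-swirl stratum** — binders
of the stub verbatim plus the local symmetry patch; the quiescence hypothesis is not even used.
[cite: KochNadirashviliSereginSverak2009, Thm 5.2 (arXiv:0709.3599 pp. 9–10)] -/
theorem quiescentLiouville_onLocallyAxisymNoSwirl :
    ∀ v : ℝ → EuclideanSpace ℝ (Fin 3) → EuclideanSpace ℝ (Fin 3),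
      ContinuousOn (Function.uncurry v) (Set.Iio 0 ×ˢ Set.univ) →
      (∃ K : ℝ, ∀ t < 0, ∀ x, ‖v t x‖ ≤ K) →
      (∀ t < 0, Literature.Analysis.FluidPDE.IsWeaklyDivFree (v t)) →
      (∀ s t : ℝ, s < t → t < 0 → ∀ x,
        v t x = Literature.Analysis.UnboundedOperators.heatExtension (v s) (t - s) x -
          Literature.Analysis.FluidPDE.oseenDuhamel 1 s v v t x) →
      (∀ ε : ℝ, 0 < ε → ∃ T : ℝ, T < 0 ∧ ∀ t < T, ∀ x y : EuclideanSpace ℝ (Fin 3),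
        dist x y ≤ 1 → ‖v t x - v t y‖ ≤ ε) →
      (∃ (t₀ : ℝ) (U : Set (EuclideanSpace ℝ (Fin 3))), t₀ < 0 ∧ IsOpen U ∧ U.Nonempty ∧
        (∀ θ : ℝ, ∀ x ∈ U, v t₀ x = rotZLIE θ (v t₀ ((rotZLIE θ).symm x))) ∧
        (∀ x ∈ U, swirl (v t₀) x = 0)) →
      ∃ b : EuclideanSpace ℝ (Fin 3), ∀ t < 0, ∀ x, v t x = b := by
  intro v hc hK hd hm _ hloc
  obtain ⟨t₀, U, ht₀, hUo, hUne, hrot, hsw⟩ := hloc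
  exact classP_const_of_locally_axisymmetric_noSwirl hc hK hd hm ht₀ hUo hUne hrot hsw

/-- **S3ᵐ (registered `stub_persistent_mild_backward_L3_recurrence`) HOLDS on the locally-axisymmetric-without-swirl
stratum**: the flow is one constant `b`, so `v(τ_k) − b ≡ 0` has `L³` norm `0 ≤ M` along `τ_k = −(k+1)`; the
persistence hypothesis is not used. [cite: KochNadirashviliSereginSverak2009, Thm 5.2 (arXiv:0709.3599 pp. 9–10)] -/
theorem persistentMild_onLocallyAxisymNoSwirl :
    ∀ v : ℝ → EuclideanSpace ℝ (Fin 3) → EuclideanSpace ℝ (Fin 3),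
      ContinuousOn (uncurry v) (Iio 0 ×ˢ univ) →
      (∃ K : ℝ, ∀ t < 0, ∀ x, ‖v t x‖ ≤ K) →
      (∀ t < 0, Literature.Analysis.FluidPDE.IsWeaklyDivFree (v t)) →
      (∀ s t : ℝ, s < t → t < 0 → ∀ x,
        v t x = Literature.Analysis.UnboundedOperators.heatExtension (v s) (t - s) x -
          Literature.Analysis.FluidPDE.oseenDuhamel 1 s v v t x) →
      (¬ ∃ C : ℝ, ∀ t < 0, ∀ x, ‖v t x‖ ≤ C / Real.sqrt (-t)) →
      (∃ (t₀ : ℝ) (U : Set (EuclideanSpace ℝ (Fin 3))), t₀ < 0 ∧ IsOpen U ∧ U.Nonempty ∧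
        (∀ θ : ℝ, ∀ x ∈ U, v t₀ x = rotZLIE θ (v t₀ ((rotZLIE θ).symm x))) ∧
        (∀ x ∈ U, swirl (v t₀) x = 0)) →
      ∃ (b : ℕ → EuclideanSpace ℝ (Fin 3)) (τ : ℕ → ℝ) (M : NNReal),
        (∀ k, τ k < 0) ∧ Tendsto τ atTop atBot ∧
        ∀ k, eLpNorm (fun x => v (τ k) x - b k) 3
          (volume : Measure (EuclideanSpace ℝ (Fin 3))) ≤ (M : ENNReal) := by
  intro v hc hK hd hm _ hloc
  obtain ⟨t₀, U, ht₀, hUo, hUne, hrot, hsw⟩ := hloc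
  obtain ⟨b, hb⟩ := classP_const_of_locally_axisymmetric_noSwirl hc hK hd hm ht₀ hUo hUne hrot hsw
  have hneg : ∀ k : ℕ, -((k : ℝ) + 1) < 0 := fun k => by
    have : (0 : ℝ) < (k : ℝ) + 1 := by positivity
    linarith
  refine ⟨fun _ => b, fun k => -((k : ℝ) + 1), 0, hneg, ?_, fun k => ?_⟩
  · exact tendsto_neg_atTop_atBot.comp
      (tendsto_atTop_add_const_right _ _ tendsto_natCast_atTop_atTop)
  · have hzero : (fun x => v (-((k : ℝ) + 1)) x - b) = fun _ => 0 := by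
      funext x; rw [hb _ (hneg k) x, sub_self]
    rw [hzero, eLpNorm_zero']
    exact bot_le

end Summit.NavierStokesRegularity.NavierStokesRegularity.Theorems.TypeILiouvilleAxisymSectors

end
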